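import Literature.AnabelianGeometry.AbsoluteAnabelian.MLFClosureUnitsInfinitelyDivisible
import Literature.AnabelianGeometry.AbsoluteAnabelian.ArithmeticLineBundlesEquivalence
import Literature.AnabelianGeometry.AbsoluteAnabelian.AutHolomorphicSpacesProofs
import Literature.AnabelianGeometry.AbsoluteAnabelian.SubpadicGaloisSlim
import Literature.AnabelianGeometry.AbsoluteAnabelian.MonoidKummerMapsProofs
import Literature.AnabelianGeometry.AbsoluteAnabelian.SubpadicSlimProofs
import Literature.AnabelianGeometry.AbsoluteAnabelian.AbsCuspCohomologyProofs
import Literature.AnabelianGeometry.AbsoluteAnabelian.AbsTopIII.BiAnabelianCoresProofs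
import Literature.AnabelianGeometry.AbsoluteAnabelian.AbsTopIII.BiAnabelianTelecoreProofs
import Literature.AnabelianGeometry.AbsoluteAnabelian.AbsTopIII.BiAnabelianDiagramsProofs
import Literature.AnabelianGeometry.AbsoluteAnabelian.AbsTopIII.AutHolLogFrobeniusProofs
import Literature.AnabelianGeometry.AbsoluteAnabelian.AbsTopI.SemiAbsoluteChainsProofs
import Literature.AnabelianGeometry.AbsoluteAnabelian.AbsTopI.ChainTransportThm

/-!
# Exact-name kernel witnesses `<Decl>_holds` for [AbsTopI–III]/[AbsAnab]/[AbsCusp]/[pGC] named facts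

abc-iut cell, D-0067 FACT-LIST (plan/FACT-LIST.md v3, owner abc-iut-dag), rule R7 (2026-08-25T23:49:42Z):
a named-fact row `def <Decl> … : Prop` counts as **proved** (and stops being an admissible
ASSUMPTION of the [IUTchIII] Cor 3.12 adjudication) only if the tree carries a theorem named exactly
`<Decl>_holds` (or lowerCamel) whose type is the universal closure of the def.  The seventeen facts below
already HAVE unconditional kernel proofs in the tree, filed by the L4 typer/prover seats under other
names (`thm_4_7_ii_holds`, `morphismCompClosed`, …); this proof-only file re-exports each of them
under the exact name, with the FULLY-QUALIFIED type, so that the row flips by the mechanical rule and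
a reader can audit the claim with one `#print axioms`.  Every right-hand side is a term of the tree;
nothing is restated, no definition is touched, no hypothesis is added or removed.  Companion table:
`HOME/staging/w5/w5-d112/FACT-LIST-L4-witnesses-w5d112.tsv` (rows F-0040 … F-1793; its rows F-0325 / F-0358 are covered by the landed lowerCamel witnesses `BiAnabelianSetting.cor_3_7_iii_holds` / `LogFrobeniusData.observableLogStmt`, which the gate's dedup identifies with the exact-name form).

typed ≠ proved for everything NOT in this file; nothing here bears on the truth of [IUTchIII] Cor 3.12.

## References
* [MochizukiAbsTopI2012] S. Mochizuki, *Topics in absolute anabelian geometry I: generalities*,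
  J. Math. Sci. Univ. Tokyo 19 (2012) — Thm 4.7 (ii)(iv) p.57.
* [MochizukiAbsTopIII2015] S. Mochizuki, *Topics in absolute anabelian geometry III: global
  reconstruction algorithms*, J. Math. Sci. Univ. Tokyo 22 (2015) — Rmk 2.3.3 p.54, Rmk 3.1.1 p.70,
  Prop 3.2 (iv) p.72, Cor 3.7 (i)–(ii) pp.87–88, Cor 4.5 (i) p.108, Def 5.3 (ii) p.124.
* [MochizukiAbsCusp2007] S. Mochizuki, *Absolute anabelian cuspidalizations of proper hyperbolic
  curves*, J. Math. Kyoto Univ. 47 (2007) — Prop 2.1 (i) p.35.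
* [MochizukiLocAn1999] S. Mochizuki, *The local pro-p anabelian geometry of curves*, Invent. Math.
  138 (1999) — Lemma 15.8 p.80; [MochizukiTopics2003] Def/Rmk 4.11 p.44.
-/

namespace Literature.AnabelianGeometry.AbsoluteAnabelian

universe u

/-- FACT-LIST F-0040, [AbsCusp] Prop 2.1 (i): exact-name witness (schema closed over all binders);
proof = `AbsCusp.prop_2_1_i_holds` (AbsCuspCohomologyProofs).
[cite: MochizukiAbsCusp2007, Prop 2.1 (i) p.35] -/
theorem AbsCusp.Prop_2_1_i_holds :
    ∀ {E' E F : FundamentalExtension.{u}} (r : E' ⟶ E) (q : E ⟶ F)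
      (hI : AbsCusp.cuspidalOver r q ≤ E'.geom),
      Literature.AnabelianGeometry.AbsoluteAnabelian.AbsCusp.Prop_2_1_i r q hI :=
  fun r q hI => AbsCusp.prop_2_1_i_holds r q hI

/-- FACT-LIST F-0041, [AbsCusp] Prop 2.1 (i) (model-relative form): exact-name witness;
proof = `AbsCusp.prop_2_1_i_model_holds`. [cite: MochizukiAbsCusp2007, Prop 2.1 (i) p.35] -/
theorem AbsCusp.Prop_2_1_i_model_holds :
    ∀ M : AbsTopIII.CurveModel.{u},
      Literature.AnabelianGeometry.AbsoluteAnabelian.AbsCusp.Prop_2_1_i_model M :=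
  fun M => AbsCusp.prop_2_1_i_model_holds M

/-- FACT-LIST F-0067, [AbsTopIII] Def 5.3 (ii) (the four functors between the additive / multiplicative
arithmetic line-bundle categories are equivalences): exact-name witness over every number field;
proof = `addMulLineBundleCategoriesEquivalent_holds` (ArithmeticLineBundlesEquivalence).
[cite: MochizukiAbsTopIII2015, Definition 5.3 (ii) p.124] -/
theorem AddMulLineBundleCategoriesEquivalent_holds :
    ∀ (F : Type) [Field F] [NumberField F],
      Literature.AnabelianGeometry.AbsoluteAnabelian.AddMulLineBundleCategoriesEquivalent F :=
  fun F _ _ => addMulLineBundleCategoriesEquivalent_holds F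

/-- FACT-LIST F-0075, [AbsTopIII] Rmk 2.3.3 (morphisms of Aut-holomorphic spaces of Riemann surfaces
are closed under composition): exact-name witness; proof = `morphismCompClosed`
(AutHolomorphicSpacesProofs). [cite: MochizukiAbsTopIII2015, Remark 2.3.3 p.54] -/
theorem MorphismCompClosed_holds :
    Literature.AnabelianGeometry.AbsoluteAnabelian.MorphismCompClosed :=
  morphismCompClosed

/-- FACT-LIST F-0174, [AbsTopIII] Prop 3.2 (iv), injectivity half (an isomorphism of MLF-Galois
`TM`-pairs is determined by its Galois component): exact-name witness; proof =
`pairIsoDeterminedByGalois_holds` (MonoidKummerMapsProofs).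
[cite: MochizukiAbsTopIII2015, Proposition 3.2 (iv) p.72] -/
theorem PairIsoDeterminedByGalois_holds :
    Literature.AnabelianGeometry.AbsoluteAnabelian.PairIsoDeterminedByGalois :=
  pairIsoDeterminedByGalois_holds

/-- FACT-LIST F-0175, [AbsTopIII] Rmk 3.1.1 (units of `𝒪_k̄` = the non-zero elements infinitely
`ℓ`-divisible inside `k(x)`): exact-name witness; proof = `unitsAreInfinitelyDivisibleElements`
(MLFClosureUnitsInfinitelyDivisible). [cite: MochizukiAbsTopIII2015, Remark 3.1.1 p.70] -/
theorem UnitsAreInfinitelyDivisibleElements_holds :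
    Literature.AnabelianGeometry.AbsoluteAnabelian.UnitsAreInfinitelyDivisibleElements :=
  unitsAreInfinitelyDivisibleElements

/-- FACT-LIST F-0185, [AbsTop]=[Mzk8] Def/Rmk 4.11 (sub-`p`-adic ⇒ generalized sub-`p`-adic, in the
tree's typing `Tpcs.Rmk_4_11`): exact-name witness; proof = `Tpcs.rmk_4_11_holds` (SubpadicGaloisSlim).
[cite: MochizukiTopics2003, Def 4.11 p.44] -/
theorem Tpcs.Rmk_4_11_holds :
    Literature.AnabelianGeometry.AbsoluteAnabelian.Tpcs.Rmk_4_11.{u} :=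
  Tpcs.rmk_4_11_holds

/-- FACT-LIST F-0262, [AbsTopI] Example 4.8 (ii) / [pGC] Lemma 15.8 in its slimness form
(`pGC.Lem_15_8_slim`): exact-name witness; proof = `pGC.lem_15_8_slim_holds` (SubpadicSlimProofs).
[cite: MochizukiAbsTopI2012, Example 4.8 (ii) p.58] -/
theorem pGC.Lem_15_8_slim_holds :
    Literature.AnabelianGeometry.AbsoluteAnabelian.pGC.Lem_15_8_slim.{u} :=
  pGC.lem_15_8_slim_holds

/-- FACT-LIST F-1793, [pGC] Lemma 15.8 (`pGC.Lem_15_8`): exact-name witness; proof =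
`pGC.lem_15_8_holds` (SubpadicSlimProofs). [cite: MochizukiLocAn1999, Lem 15.8 p.80] -/
theorem pGC.Lem_15_8_holds :
    Literature.AnabelianGeometry.AbsoluteAnabelian.pGC.Lem_15_8.{u} :=
  pGC.lem_15_8_holds

/-- FACT-LIST F-0201, [AbsTopI] Thm 4.7 (ii) (transport of Π-chains along isomorphisms of fundamental
extensions compatible with cuspidal data): exact-name witness; proof = `AbsTopI.thm_4_7_ii_holds`
(AbsTopI/ChainTransportThm). [cite: MochizukiAbsTopI2012, Theorem 4.7 (ii) p.57] -/
theorem AbsTopI.Thm_4_7_ii_holds :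
    Literature.AnabelianGeometry.AbsoluteAnabelian.AbsTopI.Thm_4_7_ii.{u} :=
  AbsTopI.thm_4_7_ii_holds

/-- FACT-LIST F-0203, [AbsTopI] Thm 4.7 (iv) (terminal homomorphisms of Π-chains are preserved by
transport): exact-name witness; proof = `AbsTopI.thm_4_7_iv_holds` (AbsTopI/SemiAbsoluteChainsProofs).
[cite: MochizukiAbsTopI2012, Theorem 4.7 (iv) p.57] -/
theorem AbsTopI.Thm_4_7_iv_holds :
    Literature.AnabelianGeometry.AbsoluteAnabelian.AbsTopI.Thm_4_7_iv.{u} :=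
  AbsTopI.thm_4_7_iv_holds

/-- FACT-LIST F-0306, [AbsTopIII] Cor 4.5 (i) (the three core statements of the archimedean
log-Frobenius diagram), for every `LogFrobeniusData`: exact-name witness; proof =
`AbsTopIII.cor_4_5_i_holds` (AbsTopIII/AutHolLogFrobeniusProofs).
[cite: MochizukiAbsTopIII2015, Corollary 4.5 (i) p.108] -/
theorem AbsTopIII.Cor_4_5_i_holds :
    ∀ Δ : LogFrobeniusData.{u}, Literature.AnabelianGeometry.AbsoluteAnabelian.AbsTopIII.Cor_4_5_i Δ :=
  fun Δ => AbsTopIII.cor_4_5_i_holds Δ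

namespace AbsTopIII.BiAnabelianSetting

open CategoryTheory

/-- FACT-LIST F-0315, [AbsTopIII] Cor 3.7 (i), Galois-core clause, for every bi-anabelian setting:
exact-name witness; proof = `galoisCoreStmt_holds` (AbsTopIII/BiAnabelianCoresProofs).
[cite: MochizukiAbsTopIII2015, Corollary 3.7 (i) p.88] -/
theorem GaloisCoreStmt_holds :
    ∀ {X E N : Type u} [Category.{u} X] [Category.{u} E] [Category.{u} N]
      (𝔖 : AbsTopIII.BiAnabelianSetting X E N),
      Literature.AnabelianGeometry.AbsoluteAnabelian.AbsTopIII.BiAnabelianSetting.GaloisCoreStmt 𝔖 :=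
  fun 𝔖 => 𝔖.galoisCoreStmt_holds

/-- FACT-LIST F-0316, [AbsTopIII] Cor 3.7 (i), reference-core clause: exact-name witness; proof =
`refCoreStmt_holds` (AbsTopIII/BiAnabelianDiagramsProofs).
[cite: MochizukiAbsTopIII2015, Corollary 3.7 (i) p.87] -/
theorem RefCoreStmt_holds :
    ∀ {X E N : Type u} [Category.{u} X] [Category.{u} E] [Category.{u} N]
      (𝔖 : AbsTopIII.BiAnabelianSetting X E N),
      Literature.AnabelianGeometry.AbsoluteAnabelian.AbsTopIII.BiAnabelianSetting.RefCoreStmt 𝔖 :=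
  fun 𝔖 => 𝔖.refCoreStmt_holds

/-- FACT-LIST F-0313, [AbsTopIII] Cor 3.7 (i) (= Galois-core ∧ reference-core clauses): exact-name
witness; proof = `cor_3_7_i_holds` (AbsTopIII/BiAnabelianCoresProofs).
[cite: MochizukiAbsTopIII2015, Corollary 3.7 (i) p.87] -/
theorem Cor_3_7_i_holds :
    ∀ {X E N : Type u} [Category.{u} X] [Category.{u} E] [Category.{u} N]
      (𝔖 : AbsTopIII.BiAnabelianSetting X E N),
      Literature.AnabelianGeometry.AbsoluteAnabelian.AbsTopIII.BiAnabelianSetting.Cor_3_7_i 𝔖 :=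
  fun 𝔖 => 𝔖.cor_3_7_i_holds

/-- FACT-LIST F-0329, [AbsTopIII] Cor 3.7 (ii), `✱`-Galois-core clause: exact-name witness; proof =
`starGaloisCoreStmt_holds` (AbsTopIII/BiAnabelianCoresProofs).
[cite: MochizukiAbsTopIII2015, Corollary 3.7 (ii) p.88] -/
theorem StarGaloisCoreStmt_holds :
    ∀ {X E N : Type u} [Category.{u} X] [Category.{u} E] [Category.{u} N]
      (𝔖 : AbsTopIII.BiAnabelianSetting X E N),
      Literature.AnabelianGeometry.AbsoluteAnabelian.AbsTopIII.BiAnabelianSetting.StarGaloisCoreStmt 𝔖 :=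
  fun 𝔖 => 𝔖.starGaloisCoreStmt_holds

/-- FACT-LIST F-0332, [AbsTopIII] Cor 3.7 (ii), telecore clause, for every bi-anabelian setting and
every bi-anabelian lift `θ` of its Galois square (the Cor 3.7 input datum): exact-name witness;
proof = `telecoreDeltaStmt_holds` (AbsTopIII/BiAnabelianTelecoreProofs).
[cite: MochizukiAbsTopIII2015, Corollary 3.7 (ii) p.87] -/
theorem TelecoreDeltaStmt_holds :
    ∀ {X E N : Type u} [Category.{u} X] [Category.{u} E] [Category.{u} N]
      (𝔖 : AbsTopIII.BiAnabelianSetting X E N) (θ : AbsTopIII.FiberSquare.BiAnabelianLift 𝔖.gal),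
      Literature.AnabelianGeometry.AbsoluteAnabelian.AbsTopIII.BiAnabelianSetting.TelecoreDeltaStmt 𝔖 θ :=
  fun 𝔖 θ => 𝔖.telecoreDeltaStmt_holds θ

end AbsTopIII.BiAnabelianSetting

end Literature.AnabelianGeometry.AbsoluteAnabelian
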